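import Mathlib
import Summits.Ventures.PercRepro2.Defs
import Summits.Ventures.PercRepro2.Independence
import Summits.Ventures.PercRepro2.Harris
import Summits.Ventures.PercRepro2.Graph
import Summits.Ventures.PercRepro2.Events
import Summits.Ventures.PercRepro2.PartitionThree
import Summits.Ventures.PercRepro2.BHKAvoid
import Summits.Ventures.PercRepro2.BHKOutside
import Summits.Ventures.PercRepro2.ZCTwoEdge
import Summits.Ventures.PercRepro2.ZCTwoEdgeGraph
import Summits.Ventures.PercRepro2.ZCA3WGraph
import Summits.Ventures.PercRepro2.ZCOA3W
import Summits.Ventures.PercRepro2.ZCOA3WGraphAux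

/-!
# Theorem I on the graph (MINE-A.md §74.5): (ZC) when `o` has degree two with neighbours `a₃` and
a non-mark `w` — the first mirror placement of §70.8 — from (ZC) on `G − o` for the marks
`(a₁, a₃, w)` and BHK06 avoidance (blind cell PercRepro2, mine-a g25)

`ends : E → Sym2 V`, `f₁ = oa₃`, `f₂ = ow` the only edges at `o`.  With `ω⁻ := ω[f₁, f₂ ↦ closed]` the
structural lemmas of `ZCTwoEdgeGraph` / `ZCA3WGraph` (and the five facts of `ZCOA3WGraphAux`) apply with `o` in the degree-two vertex's role,
`a₃` as its first and `w` as its second neighbour and `a₁` as the far vertex: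
`{a₁ ↔ o} = ({f₁} ∩ {a₁ ↔ a₃}⁻) ∪ ({f₂} ∩ {a₁ ↔ w}⁻)`, `{a₁ ↔ a₃} = {a₁ ↔ a₃}⁻ ∪ ({f₁, f₂} ∩ {a₁ ↔ w}⁻)`,
`{a₃ ↔ o} = {f₁} ∪ ({f₂} ∩ {a₃ ↔ w}⁻)`, `C(a₁) = C(o) = {o} ∪ (C⁻(a₃) if f₁) ∪ (C⁻(w) if f₂)` on
`{a₁ ↔ o}` and `C⁻(a₁)` off it.  The abstract theorem `zc_oa3w` applies with `A = {a₁ ↔ a₃}⁻`,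
`W = {a₁ ↔ w}⁻`, `Γ = {a₃ ↔ w}⁻`, `X₀ = {C⁻(a₁) ∈ 𝓔}`, `X₁ = {{o} ∪ C⁻(a₁) ∈ 𝓔}`,
`X₂ = {{o} ∪ C⁻(a₁) ∪ C⁻(w) ∈ 𝓔}`, `X₃ = {{o} ∪ C⁻(a₁) ∪ C⁻(a₃) ∈ 𝓔}`,
`X₄ = {{o} ∪ C⁻(a₁) ∪ C⁻(a₃) ∪ C⁻(w) ∈ 𝓔}`; lemma (P1) for `(a₁, a₃, w)` in `G − o` is
`partitionThree_lattice` under `p[f₁, f₂ ↦ 0]`; the inductive hypotheses are literally (ZC) under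
`p[f₁, f₂ ↦ 0]` for the marks `(a₁, a₃, w)` and the up-sets `𝓔`, `{S ∣ insert o S ∈ 𝓔}`; and the three
BHK06 inequalities are `bhk_inside_outside_avoid` under `p[f₁, f₂ ↦ 0]` (root `a₁`, avoided set `{a₃}`
or `{a₃, w}`, outside event `a₃ ↔ w`).

**Theorem** (`zc_oa3w_graph`): (ZC)_{p[f₁,f₂↦0]}(a₁, a₃, w; 𝓔) ≥ 0 ∧ (ZC)_{p[f₁,f₂↦0]}(a₁, a₃, w; 𝓔_o) ≥ 0
⇒ (ZC)_p(a₁, a₃, o; 𝓔) ≥ 0 — the `o`-role passes to its non-mark neighbour `w`.  One seat.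
-/

namespace Summit.Ventures.PercRepro2

section GraphTheoremI

variable {V : Type*} [DecidableEq V] {E : Type*} [Fintype E] [DecidableEq E] {R : Type*} [CommRing R]
  [LinearOrder R] [IsStrictOrderedRing R]

/-- **Theorem I on the graph (MINE-A.md §74.5).**  Bond percolation on a finite graph `(V, E, ends)`
in which the mark `o` is joined to the rest only by `f₁ = oa₃` and `f₂ = ow`; `𝓔` an up-set of vertex
sets.  If (ZC) holds under `p[f₁, f₂ ↦ 0]` (the graph `G − o`) for the marks `(a₁, a₃, w)` and both
up-sets `𝓔` and `{S ∣ insert o S ∈ 𝓔}`, then (ZC) `P([a₁|a₃|o]) Cov(U, {a₁a₃o}) ≥ P([a₁|a₃o]) Cov(U, {a₁a₃|o})`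
holds under `p` for the marks `(a₁, a₃, o)` and `𝓔`. -/
theorem zc_oa3w_graph [Fintype V] {p : E → R} (hp : IsProbVec p) {ends : E → Sym2 V} {a₁ a₃ o w : V}
    {f₁ f₂ : E} (hf : f₁ ≠ f₂) (hends₁ : ends f₁ = s(o, a₃)) (hends₂ : ends f₂ = s(o, w))
    (hmark : ∀ e, o ∈ ends e → e = f₁ ∨ e = f₂) (ho1 : o ≠ a₁) (ho3 : o ≠ a₃)
    {𝓔 : Set (Set V)} (h𝓔 : IsUpperSet 𝓔)
    (hZ₀ : let p' := Function.update (Function.update p f₁ 0) f₂ 0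
      let e' := connEvent ends a₁ a₃
      let L' := connEvent ends a₁ w
      let U' := clusterInEvent ends a₁ 𝓔
      let γ' := connEvent ends a₃ w
      0 ≤ prob p' (e'ᶜ ∩ L'ᶜ ∩ γ'ᶜ) * (prob p' (U' ∩ (e' ∩ L')) - prob p' U' * prob p' (e' ∩ L'))
        - prob p' (e'ᶜ ∩ L'ᶜ ∩ γ') * (prob p' (U' ∩ (e' ∩ L'ᶜ)) - prob p' U' * prob p' (e' ∩ L'ᶜ)))
    (hZ₁ : let p' := Function.update (Function.update p f₁ 0) f₂ 0
      let 𝓔' : Set (Set V) := {S | insert o S ∈ 𝓔}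
      let e' := connEvent ends a₁ a₃
      let L' := connEvent ends a₁ w
      let U' := clusterInEvent ends a₁ 𝓔'
      let γ' := connEvent ends a₃ w
      0 ≤ prob p' (e'ᶜ ∩ L'ᶜ ∩ γ'ᶜ) * (prob p' (U' ∩ (e' ∩ L')) - prob p' U' * prob p' (e' ∩ L'))
        - prob p' (e'ᶜ ∩ L'ᶜ ∩ γ') * (prob p' (U' ∩ (e' ∩ L'ᶜ)) - prob p' U' * prob p' (e' ∩ L'ᶜ))) :
    let e := connEvent ends a₁ a₃
    let L := connEvent ends a₁ o
    let U := clusterInEvent ends a₁ 𝓔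
    let γ := connEvent ends a₃ o
    0 ≤ prob p (eᶜ ∩ Lᶜ ∩ γᶜ) * (prob p (U ∩ (e ∩ L)) - prob p U * prob p (e ∩ L))
      - prob p (eᶜ ∩ Lᶜ ∩ γ) * (prob p (U ∩ (e ∩ Lᶜ)) - prob p U * prob p (e ∩ Lᶜ)) := by
  intro e L U γ
  simp only at hZ₀ hZ₁
  -- the events of `G − o`
  set A : Set (Config E) := {ω | Conn ends (Function.update (Function.update ω f₁ false) f₂ false) a₁ a₃} with hAdef
  set W : Set (Config E) := {ω | Conn ends (Function.update (Function.update ω f₁ false) f₂ false) a₁ w} with hWdef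
  set Γ : Set (Config E) := {ω | Conn ends (Function.update (Function.update ω f₁ false) f₂ false) a₃ w} with hΓdef
  set X₀ : Set (Config E) := {ω | cluster ends (Function.update (Function.update ω f₁ false) f₂ false) a₁ ∈ 𝓔} with hX₀def
  set X₁ : Set (Config E) := {ω | {o} ∪ cluster ends (Function.update (Function.update ω f₁ false) f₂ false) a₁ ∈ 𝓔} with hX₁def
  set X₂ : Set (Config E) := {ω | {o} ∪ cluster ends (Function.update (Function.update ω f₁ false) f₂ false) a₁
      ∪ cluster ends (Function.update (Function.update ω f₁ false) f₂ false) w ∈ 𝓔} with hX₂def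
  set X₃ : Set (Config E) := {ω | {o} ∪ cluster ends (Function.update (Function.update ω f₁ false) f₂ false) a₁
      ∪ cluster ends (Function.update (Function.update ω f₁ false) f₂ false) a₃ ∈ 𝓔} with hX₃def
  set X₄ : Set (Config E) := {ω | {o} ∪ cluster ends (Function.update (Function.update ω f₁ false) f₂ false) a₁
      ∪ cluster ends (Function.update (Function.update ω f₁ false) f₂ false) a₃
      ∪ cluster ends (Function.update (Function.update ω f₁ false) f₂ false) w ∈ 𝓔} with hX₄def
  -- the four graph events in the abstract form
  have hconn : ∀ ω : Config E, Conn ends ω a₁ o ↔ (ω f₁ = true ∧ ω ∈ A) ∨ (ω f₂ = true ∧ ω ∈ W) := by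
    intro ω
    have h := conn_a3_o_iff_w (a₃ := o) (a₁ := a₃) (w := w) (o := a₁) hf hends₁ hends₂ hmark ho1 ω
    simp only [A, W, Set.mem_setOf_eq]
    constructor
    · intro hc
      rcases h.1 (conn_symm hc) with ⟨h1, h2⟩ | ⟨h1, h2⟩
      · exact Or.inl ⟨h1, conn_symm h2⟩
      · exact Or.inr ⟨h1, conn_symm h2⟩
    · intro hc
      rcases hc with ⟨h1, h2⟩ | ⟨h1, h2⟩
      · exact conn_symm (h.2 (Or.inl ⟨h1, conn_symm h2⟩))
      · exact conn_symm (h.2 (Or.inr ⟨h1, conn_symm h2⟩))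
  have hL : L = (openEdge f₁ ∩ A) ∪ (openEdge f₂ ∩ W) := by
    ext ω
    simp only [L, Set.mem_union, Set.mem_inter_iff, mem_connEvent, mem_openEdge]
    exact hconn ω
  have he : e = A ∪ (openEdge f₁ ∩ openEdge f₂ ∩ W) := by
    ext ω
    have h := conn_a1_o_iff_w (a₃ := o) (a₁ := a₃) (w := w) (o := a₁) hf hends₁ hends₂ hmark ho3 ho1 ω
    simp only [e, A, W, Set.mem_union, Set.mem_inter_iff, Set.mem_setOf_eq, mem_connEvent,
      mem_openEdge]
    constructor
    · intro hc
      rcases h.1 (conn_symm hc) with h' | ⟨h1, h2, h3⟩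
      · exact Or.inl (conn_symm h')
      · exact Or.inr ⟨⟨h1, h2⟩, conn_symm h3⟩
    · intro hc
      rcases hc with h' | ⟨⟨h1, h2⟩, h3⟩
      · exact conn_symm (h.2 (Or.inl (conn_symm h')))
      · exact conn_symm (h.2 (Or.inr ⟨h1, h2, conn_symm h3⟩))
  have hγ : γ = openEdge f₁ ∪ (openEdge f₂ ∩ Γ) := by
    ext ω
    have h := conn_root_a3_iff (a₁ := o) (a₃ := a₃) (o := w) hf hends₁ hends₂ hmark ho3 ω
    simp only [γ, Γ, Set.mem_union, Set.mem_inter_iff, Set.mem_setOf_eq, mem_connEvent,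
      mem_openEdge]
    constructor
    · intro hc; exact h.1 (conn_symm hc)
    · intro hc; exact conn_symm (h.2 hc)
  have hU : U = (openEdge f₁ ∩ openEdge f₂ ∩ A ∩ Wᶜ ∩ X₂) ∪ (openEdge f₁ ∩ openEdge f₂ ∩ Aᶜ ∩ W ∩ X₃)
      ∪ (((openEdge f₁ ∩ A) ∪ (openEdge f₂ ∩ W))
          ∩ (openEdge f₁ ∩ openEdge f₂ ∩ ((A ∩ Wᶜ) ∪ (Aᶜ ∩ W)))ᶜ ∩ X₁)
      ∪ (((openEdge f₁ ∩ A) ∪ (openEdge f₂ ∩ W))ᶜ ∩ X₀) :=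
    oa3w_U_eq hf hends₁ hends₂ hmark ho1 𝓔
  -- the hypotheses of the abstract theorem: invariance under forcing `f₁`, `f₂`
  have hA : ∀ (ω : Config E) (b₁ b₂ : Bool),
      Function.update (Function.update ω f₁ b₁) f₂ b₂ ∈ A ↔ ω ∈ A := by
    intro ω b₁ b₂; simp only [A, Set.mem_setOf_eq, closeTwo_update]
  have hW : ∀ (ω : Config E) (b₁ b₂ : Bool),
      Function.update (Function.update ω f₁ b₁) f₂ b₂ ∈ W ↔ ω ∈ W := by
    intro ω b₁ b₂; simp only [W, Set.mem_setOf_eq, closeTwo_update]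
  have hΓ : ∀ (ω : Config E) (b₁ b₂ : Bool),
      Function.update (Function.update ω f₁ b₁) f₂ b₂ ∈ Γ ↔ ω ∈ Γ := by
    intro ω b₁ b₂; simp only [Γ, Set.mem_setOf_eq, closeTwo_update]
  have hX₀ : ∀ (ω : Config E) (b₁ b₂ : Bool),
      Function.update (Function.update ω f₁ b₁) f₂ b₂ ∈ X₀ ↔ ω ∈ X₀ := by
    intro ω b₁ b₂; simp only [X₀, Set.mem_setOf_eq, closeTwo_update]
  have hX₁ : ∀ (ω : Config E) (b₁ b₂ : Bool),
      Function.update (Function.update ω f₁ b₁) f₂ b₂ ∈ X₁ ↔ ω ∈ X₁ := by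
    intro ω b₁ b₂; simp only [X₁, Set.mem_setOf_eq, closeTwo_update]
  have hX₂ : ∀ (ω : Config E) (b₁ b₂ : Bool),
      Function.update (Function.update ω f₁ b₁) f₂ b₂ ∈ X₂ ↔ ω ∈ X₂ := by
    intro ω b₁ b₂; simp only [X₂, Set.mem_setOf_eq, closeTwo_update]
  have hX₃ : ∀ (ω : Config E) (b₁ b₂ : Bool),
      Function.update (Function.update ω f₁ b₁) f₂ b₂ ∈ X₃ ↔ ω ∈ X₃ := by
    intro ω b₁ b₂; simp only [X₃, Set.mem_setOf_eq, closeTwo_update]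
  -- increasing
  have hAup : IsUpperSet A := fun ω ω' hle hω => conn_mono (closeTwo_mono f₁ f₂ hle) hω
  have hWup : IsUpperSet W := fun ω ω' hle hω => conn_mono (closeTwo_mono f₁ f₂ hle) hω
  have hΓup : IsUpperSet Γ := fun ω ω' hle hω => conn_mono (closeTwo_mono f₁ f₂ hle) hω
  have hX₀up : IsUpperSet X₀ := fun ω ω' hle hω =>
    h𝓔 (cluster_mono (closeTwo_mono f₁ f₂ hle) a₁) hω
  have hX₁up : IsUpperSet X₁ := fun ω ω' hle hω =>
    h𝓔 (Set.union_subset_union_right _ (cluster_mono (closeTwo_mono f₁ f₂ hle) a₁)) hω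
  have hX₂up : IsUpperSet X₂ := fun ω ω' hle hω =>
    h𝓔 (Set.union_subset_union (Set.union_subset_union_right _
      (cluster_mono (closeTwo_mono f₁ f₂ hle) a₁)) (cluster_mono (closeTwo_mono f₁ f₂ hle) w)) hω
  have hX₃up : IsUpperSet X₃ := fun ω ω' hle hω =>
    h𝓔 (Set.union_subset_union (Set.union_subset_union_right _
      (cluster_mono (closeTwo_mono f₁ f₂ hle) a₁)) (cluster_mono (closeTwo_mono f₁ f₂ hle) a₃)) hω
  have hX₄up : IsUpperSet X₄ := fun ω ω' hle hω =>
    h𝓔 (Set.union_subset_union (Set.union_subset_union (Set.union_subset_union_right _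
      (cluster_mono (closeTwo_mono f₁ f₂ hle) a₁)) (cluster_mono (closeTwo_mono f₁ f₂ hle) a₃))
      (cluster_mono (closeTwo_mono f₁ f₂ hle) w)) hω
  -- transitivity in `G − o`
  have hWΓ : ∀ ω, ω ∈ W → ω ∈ Γ → ω ∈ A := fun ω hw hγ => conn_trans hw (conn_symm hγ)
  have hAW : ∀ ω, ω ∈ A → ω ∈ W → ω ∈ Γ := fun ω ha hw => conn_trans (conn_symm ha) hw
  have hAΓ : ∀ ω, ω ∈ A → ω ∈ Γ → ω ∈ W := fun ω ha hγ => conn_trans ha hγ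
  -- the cluster events
  have h01 : X₀ ⊆ X₁ := fun ω hω => h𝓔 Set.subset_union_right hω
  have h12 : X₁ ⊆ X₂ := fun ω hω => h𝓔 Set.subset_union_left hω
  have h13 : X₁ ⊆ X₃ := fun ω hω => h𝓔 Set.subset_union_left hω
  have h24 : X₂ ⊆ X₄ := fun ω hω => h𝓔 (by
    intro u hu
    simp only [Set.mem_union] at hu ⊢
    tauto) hω
  have h3A : X₃ ∩ A = X₁ ∩ A := by
    ext ω
    simp only [X₁, X₃, A, Set.mem_inter_iff, Set.mem_setOf_eq]
    constructor
    · rintro ⟨h, hc⟩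
      refine ⟨?_, hc⟩
      rw [← cluster_eq_of_conn hc, Set.union_assoc, Set.union_self] at h; exact h
    · rintro ⟨h, hc⟩
      refine ⟨?_, hc⟩
      rw [← cluster_eq_of_conn hc, Set.union_assoc, Set.union_self]; exact h
  have h4A : X₄ ∩ A = X₂ ∩ A := by
    ext ω
    simp only [X₂, X₄, A, Set.mem_inter_iff, Set.mem_setOf_eq]
    constructor
    · rintro ⟨h, hc⟩
      refine ⟨?_, hc⟩
      have e1 : ({o} : Set V) ∪ cluster ends (Function.update (Function.update ω f₁ false) f₂ false) a₁
          ∪ cluster ends (Function.update (Function.update ω f₁ false) f₂ false) a₃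
          ∪ cluster ends (Function.update (Function.update ω f₁ false) f₂ false) w
          = {o} ∪ cluster ends (Function.update (Function.update ω f₁ false) f₂ false) a₁
          ∪ cluster ends (Function.update (Function.update ω f₁ false) f₂ false) w := by
        rw [← cluster_eq_of_conn hc]; ext u; simp only [Set.mem_union]; tauto
      rw [e1] at h; exact h
    · rintro ⟨h, hc⟩
      refine ⟨?_, hc⟩
      have e1 : ({o} : Set V) ∪ cluster ends (Function.update (Function.update ω f₁ false) f₂ false) a₁
          ∪ cluster ends (Function.update (Function.update ω f₁ false) f₂ false) a₃
          ∪ cluster ends (Function.update (Function.update ω f₁ false) f₂ false) w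
          = {o} ∪ cluster ends (Function.update (Function.update ω f₁ false) f₂ false) a₁
          ∪ cluster ends (Function.update (Function.update ω f₁ false) f₂ false) w := by
        rw [← cluster_eq_of_conn hc]; ext u; simp only [Set.mem_union]; tauto
      rw [e1]; exact h
  have h2W : X₂ ∩ W = X₁ ∩ W := by
    ext ω
    simp only [X₁, X₂, W, Set.mem_inter_iff, Set.mem_setOf_eq]
    constructor
    · rintro ⟨h, hc⟩
      refine ⟨?_, hc⟩
      rw [← cluster_eq_of_conn hc, Set.union_assoc, Set.union_self] at h; exact h
    · rintro ⟨h, hc⟩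
      refine ⟨?_, hc⟩
      rw [← cluster_eq_of_conn hc, Set.union_assoc, Set.union_self]; exact h
  have h4W : X₄ ∩ W = X₃ ∩ W := by
    ext ω
    simp only [X₃, X₄, W, Set.mem_inter_iff, Set.mem_setOf_eq]
    constructor
    · rintro ⟨h, hc⟩
      refine ⟨?_, hc⟩
      have e1 : ({o} : Set V) ∪ cluster ends (Function.update (Function.update ω f₁ false) f₂ false) a₁
          ∪ cluster ends (Function.update (Function.update ω f₁ false) f₂ false) a₃
          ∪ cluster ends (Function.update (Function.update ω f₁ false) f₂ false) w
          = {o} ∪ cluster ends (Function.update (Function.update ω f₁ false) f₂ false) a₁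
          ∪ cluster ends (Function.update (Function.update ω f₁ false) f₂ false) a₃ := by
        rw [← cluster_eq_of_conn hc]; ext u; simp only [Set.mem_union]; tauto
      rw [e1] at h; exact h
    · rintro ⟨h, hc⟩
      refine ⟨?_, hc⟩
      have e1 : ({o} : Set V) ∪ cluster ends (Function.update (Function.update ω f₁ false) f₂ false) a₁
          ∪ cluster ends (Function.update (Function.update ω f₁ false) f₂ false) a₃
          ∪ cluster ends (Function.update (Function.update ω f₁ false) f₂ false) w
          = {o} ∪ cluster ends (Function.update (Function.update ω f₁ false) f₂ false) a₁
          ∪ cluster ends (Function.update (Function.update ω f₁ false) f₂ false) a₃ := by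
        rw [← cluster_eq_of_conn hc]; ext u; simp only [Set.mem_union]; tauto
      rw [e1]; exact h
  have h2Γ : X₂ ∩ Γ = X₃ ∩ Γ := by
    ext ω
    simp only [X₂, X₃, Γ, Set.mem_inter_iff, Set.mem_setOf_eq]
    constructor
    · rintro ⟨h, hc⟩
      refine ⟨?_, hc⟩
      rw [cluster_eq_of_conn hc]; exact h
    · rintro ⟨h, hc⟩
      refine ⟨?_, hc⟩
      rw [← cluster_eq_of_conn hc]; exact h
  have h4Γ : X₄ ∩ Γ = X₂ ∩ Γ := by
    ext ω
    simp only [X₂, X₄, Γ, Set.mem_inter_iff, Set.mem_setOf_eq]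
    constructor
    · rintro ⟨h, hc⟩
      refine ⟨?_, hc⟩
      have e1 : ({o} : Set V) ∪ cluster ends (Function.update (Function.update ω f₁ false) f₂ false) a₁
          ∪ cluster ends (Function.update (Function.update ω f₁ false) f₂ false) a₃
          ∪ cluster ends (Function.update (Function.update ω f₁ false) f₂ false) w
          = {o} ∪ cluster ends (Function.update (Function.update ω f₁ false) f₂ false) a₁
          ∪ cluster ends (Function.update (Function.update ω f₁ false) f₂ false) w := by
        rw [cluster_eq_of_conn hc]; ext u; simp only [Set.mem_union]; tauto
      rw [e1] at h; exact h
    · rintro ⟨h, hc⟩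
      refine ⟨?_, hc⟩
      have e1 : ({o} : Set V) ∪ cluster ends (Function.update (Function.update ω f₁ false) f₂ false) a₁
          ∪ cluster ends (Function.update (Function.update ω f₁ false) f₂ false) a₃
          ∪ cluster ends (Function.update (Function.update ω f₁ false) f₂ false) w
          = {o} ∪ cluster ends (Function.update (Function.update ω f₁ false) f₂ false) a₁
          ∪ cluster ends (Function.update (Function.update ω f₁ false) f₂ false) w := by
        rw [cluster_eq_of_conn hc]; ext u; simp only [Set.mem_union]; tauto
      rw [e1]; exact h
  -- lemma (P1), the inductive hypotheses and the BHK06 inequalities, from `ZCOA3WGraphAux`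
  have hP1a : prob p (A ∩ Wᶜ) * prob p (Aᶜ ∩ Wᶜ ∩ Γ) ≤ prob p (A ∩ W) * prob p (Aᶜ ∩ Wᶜ ∩ Γᶜ) :=
    oa3w_P1 hp a₁ a₃ w f₁ f₂
  have hZC₀ : 0 ≤ prob p (Aᶜ ∩ Wᶜ ∩ Γᶜ) * (prob p (X₀ ∩ (A ∩ W)) - prob p X₀ * prob p (A ∩ W))
      - prob p (Aᶜ ∩ Wᶜ ∩ Γ) * (prob p (X₀ ∩ (A ∩ Wᶜ)) - prob p X₀ * prob p (A ∩ Wᶜ)) :=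
    oa3w_ZC_shift a₁ a₃ w f₁ f₂ 𝓔 hZ₀
  have e1 : {ω : Config E | cluster ends (Function.update (Function.update ω f₁ false) f₂ false) a₁
      ∈ {S | insert o S ∈ 𝓔}} = X₁ := by
    ext ω; simp only [X₁, Set.mem_setOf_eq, Set.insert_eq]
  have hZC₁ : 0 ≤ prob p (Aᶜ ∩ Wᶜ ∩ Γᶜ) * (prob p (X₁ ∩ (A ∩ W)) - prob p X₁ * prob p (A ∩ W))
      - prob p (Aᶜ ∩ Wᶜ ∩ Γ) * (prob p (X₁ ∩ (A ∩ Wᶜ)) - prob p X₁ * prob p (A ∩ Wᶜ)) := by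
    have h := oa3w_ZC_shift (ends := ends) a₁ a₃ w f₁ f₂ {S | insert o S ∈ 𝓔} hZ₁
    rw [e1] at h
    exact h
  have h𝓔' : IsUpperSet ({S : Set V | insert o S ∈ 𝓔}) := fun S S' hle hS =>
    h𝓔 (Set.insert_subset_insert hle) hS
  have hNA₀ : prob p (X₀ ∩ (Aᶜ ∩ Wᶜ ∩ Γ)) * prob p Aᶜ ≤ prob p (X₀ ∩ Aᶜ) * prob p (Aᶜ ∩ Wᶜ ∩ Γ) :=
    oa3w_NA_single hp a₁ a₃ w f₁ f₂ h𝓔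
  have hNA₀' : prob p (X₀ ∩ (Aᶜ ∩ Wᶜ ∩ Γ)) * prob p (Aᶜ ∩ Wᶜ)
      ≤ prob p (X₀ ∩ (Aᶜ ∩ Wᶜ)) * prob p (Aᶜ ∩ Wᶜ ∩ Γ) := oa3w_NA_two hp a₁ a₃ w f₁ f₂ 𝓔 h𝓔
  have hNA₁' : prob p (X₁ ∩ (Aᶜ ∩ Wᶜ ∩ Γ)) * prob p (Aᶜ ∩ Wᶜ)
      ≤ prob p (X₁ ∩ (Aᶜ ∩ Wᶜ)) * prob p (Aᶜ ∩ Wᶜ ∩ Γ) := by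
    have h := oa3w_NA_two (ends := ends) hp a₁ a₃ w f₁ f₂ {S | insert o S ∈ 𝓔} h𝓔'
    rw [e1] at h
    exact h
  have key := zc_oa3w hp hf hA hW hΓ hX₀ hX₁ hX₂ hX₃ hAup hWup hΓup hX₀up hX₁up hX₂up hX₃up hX₄up
    hAΓ h01 h12 h13 h24 h3A h4A h2W h4W h2Γ h4Γ hP1a hNA₀ hNA₀' hNA₁' hZC₀ hZC₁
  simp only at key
  rw [hU, he, hL, hγ]
  exact key

end GraphTheoremI

end Summit.Ventures.PercRepro2
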